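import Summits.AtomisticToContinuum.HydrodynamicLimit.Theorems.InformationPercolationEnginePercolationClosesChaosRevealedDefectPairLaw
import HarnessLib

/-!
# The oscillation bound from the collision-level dictionary — steps 2–4 of `DefectOscDomination` assembled (stub S8 of the line
`equilibrium-forecast-chain-rule`, crux `InformationPercolationEngine.PercolationClosesChaos`, stmt-AtomisticToContinuum-15178)

Support file (`--supports stmt-AtomisticToContinuum-15178`) of the registered stub `stub_revealedDefectStability` (worker W6 of
lead c3). The deterministic oscillation lemma `DefectOscDomination` (`…RevealedDefectReduction.lean`, audit `S8.audit.md` §B)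
splits into step 1 — the collision-level DICTIONARY of a revealed atom, typed here as `OwnedTripleDictionary β` (same start cells,
`β`-close step-start velocities, a label-preserving bijection `Θ` of the `q`-owned collision triples with `β`-close pre-collisional
velocities and `2β`-close kicks) — and the analysis of steps 2–6. This file assembles steps 2–4 on ONE unit:
`ownedCount_mul_abs_unitDefect_sub_le` (registered headline),
`owned · |unitDefect z' − unitDefect z| ≤ 4C · roughOwnedCount + (m₁ + m₂ + 4C(E₀/V'+E₀√E₀/V'²)/s₀ + 10Cβ/s₀) · owned`,
from the per-collision atom `abs_markTest_sub_le` and the pair-law atom `abs_pairRatio_sub_le` of `…RevealedDefectPairLaw.lean`: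
`RoughFlag` / `roughOwnedCount_eq_sum` (the rough count as a sum over triples), `collPair_eq_sum_fiber`, `collRatio_eq` (collision
averages are fibre means), `abs_pairRatio_le`, `abs_markTest_sub_le_of_dict`. Steps 5–6 (choice of `V'`, `b₀`, truncation) and
the reduction `AtomDictionary → DefectOscDomination` are the companion file `…RevealedDefectAssembly.lean`. Finite-sum bookkeeping
only (`Finset.sum_image`, `Finset.sum_comp`, `Finset.sum_fiberwise_of_maps_to`).
-/

noncomputable section

open MeasureTheory Set Filter Topology
open scoped ENNReal BigOperators Classical
open Literature.Analysis.FluidPDE Literature.MathematicalPhysics.KineticTheory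
open Literature.MathematicalPhysics.KineticTheory.VelocityBlindPlacement

namespace Summit.AtomisticToContinuum.HydrodynamicLimit.Theorems.EquilibriumForecastLine

/-! ## Rough flags, fibres and the collision-level dictionary -/

section Assembly

variable {σ : ℝ} {N : ℕ} (Φ : Flow σ N)

/-- The ROUGH FLAG of an ordered contact pair `(i, j)` at time `t` of step `k` (the disjunction inside `roughOwnedCount`): `g`-grazing,
or a participant faster than `V`, or start-cell populations not `TamePair s₀ E₀` at the step start. -/
def RoughFlag (g V s₀ E₀ c : ℝ) (k : ℕ) (z : Phase N) (t : ℝ) (i j : Fin (N + 1)) : Prop :=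
  |inner ℝ ((markOf N (hsDiameter σ N) (Φ.flow t z) i j).2.1 - (markOf N (hsDiameter σ N) (Φ.flow t z) i j).2.2)
      (markOf N (hsDiameter σ N) (Φ.flow t z) i j).1| < g ∨
    V < ‖(markOf N (hsDiameter σ N) (Φ.flow t z) i j).2.1‖ ∨ V < ‖(markOf N (hsDiameter σ N) (Φ.flow t z) i j).2.2‖ ∨
    ¬ TamePair s₀ E₀ (Φ.flow ((k : ℝ) * stepLen c σ N) z)
        (pop c σ N (Φ.flow ((k : ℝ) * stepLen c σ N) z) (startCell c σ N Φ k z i))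
        (pop c σ N (Φ.flow ((k : ℝ) * stepLen c σ N) z) (startCell c σ N Φ k z j))

/-- `roughOwnedCount` as a sum over the collision triples of the step (good set). [folklore] -/
theorem roughOwnedCount_eq_sum {z : Phase N} (hz : z ∈ Φ.good) (g V s₀ E₀ c : ℝ) (k : ℕ) (q : Cell) :
    roughOwnedCount g V s₀ E₀ c σ N Φ k q z = (cellCount c σ N * c)⁻¹ * ∑ e ∈ collTriples Φ (stepWindow c σ N k) z,
      (if cellMin (startCell c σ N Φ k z e.2.1) (startCell c σ N Φ k z e.2.2) = q ∧ RoughFlag Φ g V s₀ E₀ c k z e.1 e.2.1 e.2.2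
        then (1 : ℝ) else 0) := by
  unfold roughOwnedCount RoughFlag
  rw [collisionPairSum_eq_sum_collTriples Φ hz (stepWindow_subset_Icc c σ N k)]
  congr 1
  refine Finset.sum_congr rfl fun e _ => ?_
  congr 1

/-- **The collision-level dictionary of two initial data at closeness `β`** (step 1 of the oscillation lemma, the shape the
enumeration of a revealed atom must deliver): the start cells agree sphere by sphere, the step-start velocities are `β`-close, and a
map `Θ` is a bijection from the `q`-owned collision triples of the step of `z` onto those of `z'` preserving the ordered labels,
with `β`-close pre-collisional velocities and `2β`-close kicks of the first member. -/
def OwnedTripleDictionary (β c : ℝ) (k : ℕ) (q : Cell) (z z' : Phase N) : Prop :=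
  (∀ i, startCell c σ N Φ k z' i = startCell c σ N Φ k z i) ∧
  (∀ i, ‖((Φ.flow ((k : ℝ) * stepLen c σ N) z') i).2 - ((Φ.flow ((k : ℝ) * stepLen c σ N) z) i).2‖ ≤ β) ∧
  ∃ Θ : ℝ × Fin (N + 1) × Fin (N + 1) → ℝ × Fin (N + 1) × Fin (N + 1),
    Set.BijOn Θ
      {e | e ∈ collTriples Φ (stepWindow c σ N k) z ∧ cellMin (startCell c σ N Φ k z e.2.1) (startCell c σ N Φ k z e.2.2) = q}
      {e | e ∈ collTriples Φ (stepWindow c σ N k) z' ∧ cellMin (startCell c σ N Φ k z' e.2.1) (startCell c σ N Φ k z' e.2.2) = q} ∧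
    ∀ e, e ∈ collTriples Φ (stepWindow c σ N k) z →
      cellMin (startCell c σ N Φ k z e.2.1) (startCell c σ N Φ k z e.2.2) = q →
      (Θ e).2 = e.2 ∧
      ‖(markOf N (hsDiameter σ N) (Φ.flow e.1 z) e.2.1 e.2.2).2.1 -
          (markOf N (hsDiameter σ N) (Φ.flow (Θ e).1 z') e.2.1 e.2.2).2.1‖ ≤ β ∧
      ‖(markOf N (hsDiameter σ N) (Φ.flow e.1 z) e.2.1 e.2.2).2.2 -
          (markOf N (hsDiameter σ N) (Φ.flow (Θ e).1 z') e.2.1 e.2.2).2.2‖ ≤ β ∧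
      ‖(((Φ.flow e.1 z) e.2.1).2 - (markOf N (hsDiameter σ N) (Φ.flow e.1 z) e.2.1 e.2.2).2.1) -
          (((Φ.flow (Θ e).1 z') e.2.1).2 - (markOf N (hsDiameter σ N) (Φ.flow (Θ e).1 z') e.2.1 e.2.2).2.1)‖ ≤ 2 * β

/-- **Per-triple bound (step 3 through the dictionary)**: a `q`-owned triple `e` of `z` and its partner `Θ e` in `z'` read `Ψ`
within `m₁` if `e` is not rough (`abs_markTest_sub_le`), within `2C` otherwise. [folklore] -/
theorem abs_markTest_sub_le_of_dict {z z' : Phase N} (hz : z ∈ Φ.good) (hz' : z' ∈ Φ.good) (hσ : 0 < σ)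
    {Ψ : V3 × V3 × V3 → ℝ} {C : ℝ} (hΨ : ∀ p, |Ψ p| ≤ C) {β g V s₀ E₀ c s m₁ : ℝ} {k : ℕ} {q : Cell}
    (hg : 0 < g) (hβ1 : β ≤ 1) (hs4 : 4 * β / g ≤ s) (hsβ : β ≤ s)
    (hmod : ∀ (ω ω' a b a' b' : V3), ‖ω‖ = 1 → ‖ω'‖ = 1 → ‖a‖ ≤ V + 1 → ‖b‖ ≤ V + 1 → ‖a'‖ ≤ V + 1 → ‖b'‖ ≤ V + 1 →
      ‖ω - ω'‖ ≤ s → ‖a - a'‖ ≤ s → ‖b - b'‖ ≤ s → |Ψ (ω, a, b) - Ψ (ω', a', b')| ≤ m₁)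
    {Θ : ℝ × Fin (N + 1) × Fin (N + 1) → ℝ × Fin (N + 1) × Fin (N + 1)}
    (hΘ : Set.BijOn Θ
      {e | e ∈ collTriples Φ (stepWindow c σ N k) z ∧ cellMin (startCell c σ N Φ k z e.2.1) (startCell c σ N Φ k z e.2.2) = q}
      {e | e ∈ collTriples Φ (stepWindow c σ N k) z' ∧ cellMin (startCell c σ N Φ k z' e.2.1) (startCell c σ N Φ k z' e.2.2) = q})
    (hΘe : ∀ e, e ∈ collTriples Φ (stepWindow c σ N k) z →
      cellMin (startCell c σ N Φ k z e.2.1) (startCell c σ N Φ k z e.2.2) = q →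
      (Θ e).2 = e.2 ∧
      ‖(markOf N (hsDiameter σ N) (Φ.flow e.1 z) e.2.1 e.2.2).2.1 -
          (markOf N (hsDiameter σ N) (Φ.flow (Θ e).1 z') e.2.1 e.2.2).2.1‖ ≤ β ∧
      ‖(markOf N (hsDiameter σ N) (Φ.flow e.1 z) e.2.1 e.2.2).2.2 -
          (markOf N (hsDiameter σ N) (Φ.flow (Θ e).1 z') e.2.1 e.2.2).2.2‖ ≤ β ∧
      ‖(((Φ.flow e.1 z) e.2.1).2 - (markOf N (hsDiameter σ N) (Φ.flow e.1 z) e.2.1 e.2.2).2.1) -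
          (((Φ.flow (Θ e).1 z') e.2.1).2 - (markOf N (hsDiameter σ N) (Φ.flow (Θ e).1 z') e.2.1 e.2.2).2.1)‖ ≤ 2 * β)
    {e : ℝ × Fin (N + 1) × Fin (N + 1)} (he : e ∈ collTriples Φ (stepWindow c σ N k) z)
    (hown : cellMin (startCell c σ N Φ k z e.2.1) (startCell c σ N Φ k z e.2.2) = q) :
    |Ψ (markOf N (hsDiameter σ N) (Φ.flow e.1 z) e.2.1 e.2.2) -
        Ψ (markOf N (hsDiameter σ N) (Φ.flow (Θ e).1 z') e.2.1 e.2.2)| ≤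
      if RoughFlag Φ g V s₀ E₀ c k z e.1 e.2.1 e.2.2 then 2 * C else m₁ := by
  by_cases hr : RoughFlag Φ g V s₀ E₀ c k z e.1 e.2.1 e.2.2
  · rw [if_pos hr, two_mul]
    exact (abs_sub _ _).trans (add_le_add (hΨ _) (hΨ _))
  · rw [if_neg hr]
    simp only [RoughFlag, not_or, not_lt, not_not] at hr
    obtain ⟨hgraz, hvV, hwV, -⟩ := hr
    obtain ⟨hlab, hv, hw, hkick⟩ := hΘe e he hown
    have hp : (e.2.1, e.2.2) ∈ contactPairs G3 (hsDiameter σ N) (Φ.flow e.1 z) :=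
      ((mem_collTriples Φ hz (stepWindow_subset_Icc c σ N k)).1 he).2
    have hΘmem := hΘ.mapsTo ⟨he, hown⟩
    have hp' : (e.2.1, e.2.2) ∈ contactPairs G3 (hsDiameter σ N) (Φ.flow (Θ e).1 z') := by
      have h := ((mem_collTriples Φ hz' (stepWindow_subset_Icc c σ N k)).1 hΘmem.1).2
      rw [hlab] at h
      exact h
    exact abs_markTest_sub_le Φ hz hz' hσ hp hp' Ψ hg hβ1 hs4 hsβ hgraz hvV hwV hv hw hkick hmod

/-- `collPair Ξ (a, b)` as a sum over the FIBRE of the start-cell pair `(a, b)` among the triples of the step. [folklore] -/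
theorem collPair_eq_sum_fiber {z : Phase N} (hz : z ∈ Φ.good) (Ξ : V3 × V3 × V3 → ℝ) (c : ℝ) (k : ℕ) (a b : Cell) :
    collPair Ξ c σ N Φ k a b z = (cellCount c σ N * c)⁻¹ *
      ∑ e ∈ (collTriples Φ (stepWindow c σ N k) z).filter
          (fun e => startCell c σ N Φ k z e.2.1 = a ∧ startCell c σ N Φ k z e.2.2 = b),
        Ξ (markOf N (hsDiameter σ N) (Φ.flow e.1 z) e.2.1 e.2.2) := by
  rw [collPair_eq_sum Φ hz, Finset.sum_filter]

/-- The collision average `collPair Ψ / collPair 1` of a start-cell pair is the mean of `Ψ(mark)` over its fibre (`0/0 = 0` on an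
empty fibre on both sides). [folklore] -/
theorem collRatio_eq {z : Phase N} (hz : z ∈ Φ.good) (Ψ : V3 × V3 × V3 → ℝ) {c : ℝ} (hc : 0 < c) (hσ : 0 < σ) (k : ℕ)
    (a b : Cell) :
    collPair Ψ c σ N Φ k a b z / collPair (fun _ => 1) c σ N Φ k a b z =
      (∑ e ∈ (collTriples Φ (stepWindow c σ N k) z).filter
          (fun e => startCell c σ N Φ k z e.2.1 = a ∧ startCell c σ N Φ k z e.2.2 = b),
        Ψ (markOf N (hsDiameter σ N) (Φ.flow e.1 z) e.2.1 e.2.2)) /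
      ((((collTriples Φ (stepWindow c σ N k) z).filter
          (fun e => startCell c σ N Φ k z e.2.1 = a ∧ startCell c σ N Φ k z e.2.2 = b)).card : ℕ) : ℝ) := by
  have hn : (cellCount c σ N * c)⁻¹ ≠ 0 := inv_ne_zero (mul_pos (cellCount_pos hc hσ N) hc).ne'
  rw [collPair_eq_sum_fiber Φ hz, collPair_eq_sum_fiber Φ hz, mul_div_mul_left _ _ hn]
  congr 1
  rw [Finset.card_eq_sum_ones, Nat.cast_sum, Nat.cast_one]

/-- `|pairPair Ψ / pairPair 1| ≤ C` for a continuous mark test bounded by `C`. [folklore] -/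
theorem abs_pairRatio_le {z : Phase N} {Ψ : V3 × V3 × V3 → ℝ} (hΨc : Continuous Ψ) {C : ℝ} (hΨ : ∀ p, |Ψ p| ≤ C)
    (c : ℝ) (k : ℕ) (a b : Cell) :
    |pairPair Ψ c σ N Φ k a b z / pairPair (fun _ => 1) c σ N Φ k a b z| ≤ C :=
  abs_div_le_of_abs_le_mul (pairPair_one_nonneg Φ c k a b z) ((abs_nonneg _).trans (hΨ 0)) (abs_pairPair_le Φ hΨc hΨ c k a b z)

end Assembly

/-- **Registered headline `ownedCount_mul_abs_unitDefect_sub_le` — steps 2–4 of the oscillation lemma assembled: the oscillation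
bound from the collision-level dictionary.** For two good initial data related by `OwnedTripleDictionary β`, a bounded continuous
mark test with moduli `m₁` (on `S² × B̄_{V+1}²` at scale `s ≥ 4β/g ∨ β`) and `m₂` (at fixed `ω`, speeds `≤ V'`, scale `β`):
`owned · |unitDefect z' − unitDefect z| ≤ 4C · rough + (m₁ + m₂ + 4C(E₀/V' + E₀√E₀/V'²)/s₀ + 10Cβ/s₀) · owned`.
Proof: `owned · unitDefect` is the sum of `|A − P|` over the owned triples (`ownedCount_mul_unitDefect_eq`), reindexed by `Θ` for
`z'`; the pair-law terms `|ΔP|` pay `abs_pairRatio_sub_le` on tame pairs and `2C` on untame (hence rough) ones; the collision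
averages `A` are fibre means (`collRatio_eq`), the fibres of `z'` are the `Θ`-images of those of `z`, so `Σ_owned |ΔA| ≤ Σ_owned`
of the per-triple bounds (`Finset.sum_comp`, `Finset.sum_fiberwise_of_maps_to`), which pay `m₁` or `2C` (`abs_markTest_sub_le_of_dict`).
[folklore] -/
theorem ownedCount_mul_abs_unitDefect_sub_le : ∀ {σ : ℝ} {N : ℕ} (Φ : Flow σ N) {z z' : Phase N}, z ∈ Φ.good → z' ∈ Φ.good → 0 < σ → ∀ {Ψ : V3 × V3 × V3 → ℝ}, Continuous Ψ → ∀ {C : ℝ}, (∀ p, |Ψ p| ≤ C) → ∀ {c : ℝ}, 0 < c → ∀ (k : ℕ) (q : Cell) {β g V s₀ E₀ V' s m₁ m₂ : ℝ}, 0 ≤ β → β ≤ 1 → 0 < g → 0 < s₀ → 0 ≤ E₀ → 0 < V' → 4 * β / g ≤ s → β ≤ s → 0 ≤ m₁ → 0 ≤ m₂ → (∀ (ω ω' a b a' b' : V3), ‖ω‖ = 1 → ‖ω'‖ = 1 → ‖a‖ ≤ V + 1 → ‖b‖ ≤ V + 1 → ‖a'‖ ≤ V + 1 → ‖b'‖ ≤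 V + 1 → ‖ω - ω'‖ ≤ s → ‖a - a'‖ ≤ s → ‖b - b'‖ ≤ s → |Ψ (ω, a, b) - Ψ (ω', a', b')| ≤ m₁) → (∀ (ω : Metric.sphere (0 : V3) 1) (a b a' b' : V3), ‖a‖ ≤ V' → ‖b‖ ≤ V' → ‖a' - a‖ ≤ β → ‖b' - b‖ ≤ β → |Ψ ((ω : V3), a, b) - Ψ ((ω : V3), a', b')| ≤ m₂) → OwnedTripleDictionary Φ β c k q z z' → ownedCount c σ N Φ k q z * |unitDefect Ψ c σ N Φ k q z' - unitDefect Ψ c σ N Φ k q z| ≤ 4 * C * roughOwnedCount g V s₀ E₀ c σ N Φ k q z + (m₁ + (m₂ + 4 * C * (E₀ / V' + E₀ * Real.sqrt E₀ / V' ^ 2) / s₀ + 10 * C * β / s₀)) * ownedCount c σ N Φ k q z := by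
  intro σ N Φ z z' hz hz' hσ Ψ hΨc C hΨ c hc k q β g V s₀ E₀ V' s m₁ m₂ hβ hβ1 hg hs₀ hE0 hV' hs4 hsβ hm₁ hm₂ hmod₁ hmod₂ hD
  obtain ⟨hcell, hvel, Θ, hΘ, hΘe⟩ := hD
  have hC : 0 ≤ C := (abs_nonneg _).trans (hΨ 0)
  -- notation
  set T := collTriples Φ (stepWindow c σ N k) z with hT
  set T' := collTriples Φ (stepWindow c σ N k) z' with hT'
  set sc := startCell c σ N Φ k z with hsc
  have hsc' : startCell c σ N Φ k z' = sc := funext hcell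
  set own : ℝ × Fin (N + 1) × Fin (N + 1) → Prop := fun e => cellMin (sc e.2.1) (sc e.2.2) = q with hown
  set O := T.filter own with hO
  set O' := T'.filter own with hO'
  set κ := (cellCount c σ N * c)⁻¹ with hκ
  have hκ0 : 0 < κ := inv_pos.2 (mul_pos (cellCount_pos hc hσ N) hc)
  set ρ := m₂ + 4 * C * (E₀ / V' + E₀ * Real.sqrt E₀ / V' ^ 2) / s₀ + 10 * C * β / s₀ with hρ
  have hρ0 : 0 ≤ ρ := by positivity
  set rf : ℝ × Fin (N + 1) × Fin (N + 1) → Prop := fun e => RoughFlag Φ g V s₀ E₀ c k z e.1 e.2.1 e.2.2 with hrf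
  set B : ℝ × Fin (N + 1) × Fin (N + 1) → ℝ := fun e => if rf e then 2 * C else m₁ with hB
  set π : ℝ × Fin (N + 1) × Fin (N + 1) → Cell × Cell := fun e => (sc e.2.1, sc e.2.2) with hπ
  set A : Phase N → Cell × Cell → ℝ := fun w p =>
    collPair Ψ c σ N Φ k p.1 p.2 w / collPair (fun _ => 1) c σ N Φ k p.1 p.2 w with hA
  set P : Phase N → Cell × Cell → ℝ := fun w p =>
    pairPair Ψ c σ N Φ k p.1 p.2 w / pairPair (fun _ => 1) c σ N Φ k p.1 p.2 w with hP
  have hrd : ∀ (w : Phase N) (e : ℝ × Fin (N + 1) × Fin (N + 1)),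
      relDefect Ψ c σ N Φ k (sc e.2.1) (sc e.2.2) w = A w (π e) - P w (π e) := fun w e => rfl
  -- the bijection on finsets
  have hOcoe : (↑O : Set (ℝ × Fin (N + 1) × Fin (N + 1))) =
      {e | e ∈ collTriples Φ (stepWindow c σ N k) z ∧ cellMin (startCell c σ N Φ k z e.2.1) (startCell c σ N Φ k z e.2.2) = q} := by
    ext e
    rw [hO, Finset.coe_filter]
  have hO'coe : (↑O' : Set (ℝ × Fin (N + 1) × Fin (N + 1))) =
      {e | e ∈ collTriples Φ (stepWindow c σ N k) z' ∧
        cellMin (startCell c σ N Φ k z' e.2.1) (startCell c σ N Φ k z' e.2.2) = q} := by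
    ext e
    rw [hO', Finset.coe_filter]
    simp only [Set.mem_setOf_eq, hcell]
    exact Iff.rfl
  have hΘ' : Set.BijOn Θ ↑O ↑O' := by rw [hOcoe, hO'coe]; exact hΘ
  have hinj : Set.InjOn Θ ↑O := hΘ'.injOn
  have himage : O.image Θ = O' := Finset.coe_injective (by rw [Finset.coe_image, hΘ'.image_eq])
  have hmemO : ∀ {e}, e ∈ O ↔ e ∈ T ∧ own e := fun {e} => Finset.mem_filter
  have hlab : ∀ e ∈ O, (Θ e).2 = e.2 := fun e he => (hΘe e (hmemO.1 he).1 (hmemO.1 he).2).1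
  have hΘT' : ∀ e ∈ O, Θ e ∈ T' := fun e he => by
    have h := hΘ'.mapsTo (Finset.mem_coe.2 he)
    exact (Finset.mem_filter.1 (Finset.mem_coe.1 h)).1
  -- counts and products as sums over `O`
  have hoc : ownedCount c σ N Φ k q z = κ * O.card := by
    rw [ownedCount_eq_sum Φ hz, ← hκ, hO, Finset.card_eq_sum_ones, Nat.cast_sum, Nat.cast_one, Finset.sum_filter]
  have hcardO' : O'.card = O.card := by rw [← himage, Finset.card_image_of_injOn hinj]
  have hoc' : ownedCount c σ N Φ k q z' = κ * O.card := by
    rw [ownedCount_eq_sum Φ hz', ← hκ, hsc', ← hcardO', hO', Finset.card_eq_sum_ones, Nat.cast_sum, Nat.cast_one,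
      Finset.sum_filter]
  have hrough : roughOwnedCount g V s₀ E₀ c σ N Φ k q z = κ * (O.filter rf).card := by
    rw [roughOwnedCount_eq_sum Φ hz, ← hκ, hO, Finset.filter_filter, Finset.card_eq_sum_ones, Nat.cast_sum, Nat.cast_one,
      Finset.sum_filter]
  have hprod : ownedCount c σ N Φ k q z * unitDefect Ψ c σ N Φ k q z = κ * ∑ e ∈ O, |A z (π e) - P z (π e)| := by
    rw [ownedCount_mul_unitDefect_eq Φ hz Ψ hc hσ k q, ← hκ, hO, Finset.sum_filter]
    rfl
  have hprod' : ownedCount c σ N Φ k q z' * unitDefect Ψ c σ N Φ k q z' = κ * ∑ e ∈ O, |A z' (π e) - P z' (π e)| := by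
    rw [ownedCount_mul_unitDefect_eq Φ hz' Ψ hc hσ k q, ← hκ, hsc', ← Finset.sum_filter]
    change κ * ∑ e ∈ O', |relDefect Ψ c σ N Φ k (sc e.2.1) (sc e.2.2) z'| = _
    rw [← himage, Finset.sum_image fun x hx y hy h => hinj (Finset.mem_coe.2 hx) (Finset.mem_coe.2 hy) h]
    congr 1
    refine Finset.sum_congr rfl fun e he => ?_
    have h2 := hlab e he
    rw [show (Θ e).2.1 = e.2.1 by rw [h2], show (Θ e).2.2 = e.2.2 by rw [h2]]
    rfl
  -- the P-term per owned triple
  have hPterm : ∀ e ∈ O, |P z' (π e) - P z (π e)| ≤ ρ + (if rf e then 2 * C else 0) := by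
    intro e he
    by_cases ht : TamePair s₀ E₀ (Φ.flow ((k : ℝ) * stepLen c σ N) z)
        (pop c σ N (Φ.flow ((k : ℝ) * stepLen c σ N) z) (sc e.2.1)) (pop c σ N (Φ.flow ((k : ℝ) * stepLen c σ N) z) (sc e.2.2))
    · have h := abs_pairRatio_sub_le Φ hΨc hΨ hc hσ k (sc e.2.1) (sc e.2.2) hcell hβ hvel hs₀ hE0 ht hV' hm₂ hmod₂
      rw [abs_sub_comm]
      have h0 : 0 ≤ (if rf e then 2 * C else 0 : ℝ) := by split_ifs <;> positivity
      exact h.trans (by linarith)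
    · have hr : rf e := Or.inr (Or.inr (Or.inr ht))
      rw [if_pos hr]
      calc |P z' (π e) - P z (π e)| ≤ |P z' (π e)| + |P z (π e)| := abs_sub _ _
        _ ≤ C + C := add_le_add (abs_pairRatio_le Φ hΨc hΨ c k _ _) (abs_pairRatio_le Φ hΨc hΨ c k _ _)
        _ ≤ ρ + 2 * C := by linarith
  -- the A-term: fibres
  have hfib : ∀ p : Cell × Cell, cellMin p.1 p.2 = q →
      T.filter (fun e => sc e.2.1 = p.1 ∧ sc e.2.2 = p.2) = O.filter (fun e => π e = p) := by
    intro p hp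
    ext e
    simp only [Finset.mem_filter, hmemO, hπ, hown, Prod.ext_iff]
    constructor
    · rintro ⟨heT, h1, h2⟩
      exact ⟨⟨heT, by rw [h1, h2]; exact hp⟩, h1, h2⟩
    · rintro ⟨⟨heT, -⟩, h1, h2⟩
      exact ⟨heT, h1, h2⟩
  have hfib' : ∀ p : Cell × Cell, cellMin p.1 p.2 = q →
      T'.filter (fun e => sc e.2.1 = p.1 ∧ sc e.2.2 = p.2) = (O.filter (fun e => π e = p)).image Θ := by
    intro p hp
    ext x
    constructor
    · intro hx
      obtain ⟨hxT', h12⟩ := Finset.mem_filter.1 hx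
      have hxO' : x ∈ O' := by
        refine Finset.mem_filter.2 ⟨hxT', ?_⟩
        show cellMin (sc x.2.1) (sc x.2.2) = q
        rw [h12.1, h12.2]; exact hp
      rw [← himage] at hxO'
      obtain ⟨e, heO, hex⟩ := Finset.mem_image.1 hxO'
      refine Finset.mem_image.2 ⟨e, Finset.mem_filter.2 ⟨heO, ?_⟩, hex⟩
      have h3 := hlab e heO
      rw [← hex] at h12
      show (sc e.2.1, sc e.2.2) = p
      rw [← h3]
      exact Prod.ext h12.1 h12.2
    · intro hx
      obtain ⟨e, he, hex⟩ := Finset.mem_image.1 hx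
      obtain ⟨heO, hπe⟩ := Finset.mem_filter.1 he
      subst hex
      have h3 := hlab e heO
      have hπe' : sc e.2.1 = p.1 ∧ sc e.2.2 = p.2 := Prod.ext_iff.1 hπe
      refine Finset.mem_filter.2 ⟨hΘT' e heO, ?_, ?_⟩
      · rw [h3]; exact hπe'.1
      · rw [h3]; exact hπe'.2
  have hAfib : ∀ p ∈ O.image π,
      ((O.filter (fun e => π e = p)).card : ℝ) * |A z' p - A z p| ≤ ∑ e ∈ O.filter (fun e => π e = p), B e := by
    intro p hp
    obtain ⟨e₀, he₀, rfl⟩ := Finset.mem_image.1 hp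
    have hown₀ : cellMin (π e₀).1 (π e₀).2 = q := (hmemO.1 he₀).2
    set F := O.filter (fun e => π e = π e₀) with hF
    have hinjF : Set.InjOn Θ ↑F := hinj.mono (by rw [hF, Finset.coe_filter]; exact fun x hx => hx.1)
    have hAz : A z (π e₀) = (∑ e ∈ F, Ψ (markOf N (hsDiameter σ N) (Φ.flow e.1 z) e.2.1 e.2.2)) / F.card := by
      simp only [hA]
      rw [collRatio_eq Φ hz Ψ hc hσ k, hfib _ hown₀]
    have hAz' : A z' (π e₀) = (∑ e ∈ F, Ψ (markOf N (hsDiameter σ N) (Φ.flow (Θ e).1 z') e.2.1 e.2.2)) / F.card := by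
      simp only [hA]
      rw [collRatio_eq Φ hz' Ψ hc hσ k, hsc', hfib' _ hown₀, Finset.card_image_of_injOn hinjF,
        Finset.sum_image fun x hx y hy h => hinjF (Finset.mem_coe.2 hx) (Finset.mem_coe.2 hy) h]
      congr 1
      refine Finset.sum_congr rfl fun e he => ?_
      have h3 := hlab e (Finset.mem_filter.1 he).1
      rw [show (Θ e).2.1 = e.2.1 by rw [h3], show (Θ e).2.2 = e.2.2 by rw [h3]]
    rcases Nat.eq_zero_or_pos F.card with h0 | hpos
    · rw [h0, Nat.cast_zero, zero_mul]
      exact Finset.sum_nonneg fun e _ => by simp only [hB]; split_ifs <;> positivity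
    have hFpos : (0 : ℝ) < F.card := by exact_mod_cast hpos
    rw [hAz, hAz', ← sub_div, abs_div, abs_of_pos hFpos, mul_div_cancel₀ _ hFpos.ne', ← Finset.sum_sub_distrib]
    refine (Finset.abs_sum_le_sum_abs _ _).trans (Finset.sum_le_sum fun e he => ?_)
    have heO := (Finset.mem_filter.1 he).1
    rw [abs_sub_comm]
    exact abs_markTest_sub_le_of_dict Φ hz hz' hσ hΨ hg hβ1 hs4 hsβ hmod₁ hΘ hΘe (hmemO.1 heO).1 (hmemO.1 heO).2
  have hAsum : ∑ e ∈ O, |A z' (π e) - A z (π e)| ≤ ∑ e ∈ O, B e := by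
    rw [Finset.sum_comp (fun p => |A z' p - A z p|) π]
    calc ∑ p ∈ O.image π, (O.filter (fun e => π e = p)).card • |A z' p - A z p|
        ≤ ∑ p ∈ O.image π, ∑ e ∈ O.filter (fun e => π e = p), B e :=
          Finset.sum_le_sum fun p hp => by rw [nsmul_eq_mul]; exact hAfib p hp
      _ = ∑ e ∈ O, B e := Finset.sum_fiberwise_of_maps_to (fun e he => Finset.mem_image_of_mem π he) B
  -- summing `B` and the P-terms
  have hBsum : ∑ e ∈ O, B e ≤ m₁ * O.card + 2 * C * (O.filter rf).card := by
    have : ∀ e ∈ O, B e ≤ m₁ + (if rf e then 2 * C else 0) := by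
      intro e _; simp only [hB]; split_ifs <;> linarith
    refine (Finset.sum_le_sum this).trans (le_of_eq ?_)
    rw [Finset.sum_add_distrib, Finset.sum_const, nsmul_eq_mul, ← Finset.sum_filter, Finset.sum_const, nsmul_eq_mul]
    ring
  have hPsum : ∑ e ∈ O, |P z' (π e) - P z (π e)| ≤ ρ * O.card + 2 * C * (O.filter rf).card := by
    refine (Finset.sum_le_sum hPterm).trans (le_of_eq ?_)
    rw [Finset.sum_add_distrib, Finset.sum_const, nsmul_eq_mul, ← Finset.sum_filter, Finset.sum_const, nsmul_eq_mul]
    ring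
  -- conclusion
  have hkey : ownedCount c σ N Φ k q z * |unitDefect Ψ c σ N Φ k q z' - unitDefect Ψ c σ N Φ k q z| =
      κ * |∑ e ∈ O, (|A z' (π e) - P z' (π e)| - |A z (π e) - P z (π e)|)| := by
    have hoc0 : 0 ≤ ownedCount c σ N Φ k q z := ownedCount_nonneg hc.le hσ Φ k q z
    have hoceq : ownedCount c σ N Φ k q z' = ownedCount c σ N Φ k q z := hoc'.trans hoc.symm
    calc ownedCount c σ N Φ k q z * |unitDefect Ψ c σ N Φ k q z' - unitDefect Ψ c σ N Φ k q z|
        = |ownedCount c σ N Φ k q z * unitDefect Ψ c σ N Φ k q z' - ownedCount c σ N Φ k q z * unitDefect Ψ c σ N Φ k q z| := by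
          rw [← mul_sub, abs_mul, abs_of_nonneg hoc0]
      _ = |ownedCount c σ N Φ k q z' * unitDefect Ψ c σ N Φ k q z' - ownedCount c σ N Φ k q z * unitDefect Ψ c σ N Φ k q z| := by
          rw [hoceq]
      _ = κ * |∑ e ∈ O, (|A z' (π e) - P z' (π e)| - |A z (π e) - P z (π e)|)| := by
          rw [hprod', hprod, ← mul_sub, abs_mul, abs_of_pos hκ0, Finset.sum_sub_distrib]
  rw [hkey, hrough, hoc]
  have hsum : |∑ e ∈ O, (|A z' (π e) - P z' (π e)| - |A z (π e) - P z (π e)|)| ≤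
      (m₁ + ρ) * O.card + 4 * C * (O.filter rf).card := by
    refine (Finset.abs_sum_le_sum_abs _ _).trans ?_
    have hterm : ∀ e ∈ O, |(|A z' (π e) - P z' (π e)| - |A z (π e) - P z (π e)|)| ≤
        |A z' (π e) - A z (π e)| + |P z' (π e) - P z (π e)| := by
      intro e _
      refine (abs_abs_sub_abs_le_abs_sub _ _).trans ?_
      calc |A z' (π e) - P z' (π e) - (A z (π e) - P z (π e))|
          = |(A z' (π e) - A z (π e)) - (P z' (π e) - P z (π e))| := by ring_nf
        _ ≤ _ := abs_sub _ _
    refine (Finset.sum_le_sum hterm).trans ?_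
    rw [Finset.sum_add_distrib]
    linarith [hAsum, hBsum, hPsum]
  calc κ * |∑ e ∈ O, (|A z' (π e) - P z' (π e)| - |A z (π e) - P z (π e)|)|
      ≤ κ * ((m₁ + ρ) * O.card + 4 * C * (O.filter rf).card) := mul_le_mul_of_nonneg_left hsum hκ0.le
    _ = 4 * C * (κ * (O.filter rf).card) + (m₁ + ρ) * (κ * O.card) := by ring

end Summit.AtomisticToContinuum.HydrodynamicLimit.Theorems.EquilibriumForecastLine

end
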